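import Literature.IUT.HodgeTheaters.PuncturedEllipticCoveringsCor12TorsionFreeFaithful
import HarnessLib

/-!
# [IUTchI] Cor. 1.2: uniqueness of the semi-elliptic double cover (`huniq`) from ONE origin law of the orbicurve
# `C = X/{±1}` — "`Δ_C` is topologically generated by its elements of finite order" — proof-only

Mochizuki, *Inter-universal Teichmüller theory I*, kurims manuscript (May 2020), §1 p. 37 ("`X` a hyperbolic curve
of type `(1,1)` … the quotient of `X` by the unique `k`-involution `−1` … a hyperbolic orbicurve `C`"), Cor. 1.2 proof
p. 39 l. 24–27 ("[AbsTopII], Corollary 3.3, (i), (ii) … allow one to reconstruct … the subgroups `Δ_X ⊆ Δ_C ⊆ Π_C`")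
[cite: Mochizuki2012, IUTchI Cor 1.2 p.39] (D-0012 claim key; series status DISPUTED — nothing of the series is
asserted); S. Mochizuki, *Topics in Absolute Anabelian Geometry II*, J. Math. Sci. Univ. Tokyo **20** (2013),
Cor. 3.3 (ii) p. 68 / Remark 3.1.1 ("the unique finite étale double covering … by a hyperbolic curve")
[cite: MochizukiAbsTopII2013, Cor 3.3 (ii) p.68].

PROOF-ONLY file (cell abc-iut, seat abc-iut-L5-t1 gen 11, row «COR12-HUNIQ-FROM-TORSION-GENERATION», HUB census
`plan/L5/SUBDAG-IUTchI-Cor12.md`).  The Cor. 1.2 closer of record after the T1g11-F1 repair,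
`InitialThetaData.pe_characteristicNatureOfCoverings_viaX_of_freePro_faithful` (p492999), displays at the primed
datum the [AbsTopII] Cor. 3.3 (ii)-shaped LAW
`huniq : ∀ J, IsOpen J → J.index = 2 → (J ∩ Δ'_C torsion-free) → J ∩ Δ'_C = Δ'_X` (uniqueness of the double cover
of `C'` by a hyperbolic CURVE).  Here it is DERIVED from ONE elementary ORIGIN LAW of the orbicurve `C = X/{±1}`:

  (e) `Δ_C ≤ (closure {g ∈ Δ_C | g of finite order})⁻` — "`Δ_C` is topologically generated by its torsion"

(classically: `C_k̄ = (E ∖ {O})/{±1}` is `ℙ¹` minus one point with three orbifold points of order `2`, so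
`Δ_C ≅ (ℤ/2 ∗ ℤ/2 ∗ ℤ/2)^` is topologically generated by involutions), together with the torsion-freeness of
`Δ_X` (print's "`X` is a scheme", [AbsTopI] Lem. 4.1 (iv)) — which p491635
`PuncturedEllipticData.torsionFree_deltaX_of_isFreeProOn` already derives from «`Δ_X` free profinite of rank 2»:
* `inf_deltaC_eq_of_torsionGenerated` — for `J ⊆ Π_C` open of index `2` with `J ∩ Δ_C` torsion-free:
  `J ∩ Δ_C = Δ_X`.  PROOF: `S := {g | g ∈ J ↔ g ∈ Π_X}` is a subgroup (both `J` and `Π_X` have index `2`: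
  Mathlib `Subgroup.mul_mem_iff_of_index_two`), clopen, and contains every finite-order element of `Δ_C` (such an
  element lies in `J`, resp. `Π_X`, iff it is trivial, by the two torsion-freeness hypotheses); hence `S ⊇ Δ_C` by
  (e), i.e. `J ∩ Δ_C = Π_X ∩ Δ_C`;
* `InitialThetaData.pe_characteristicNatureOfCoverings_viaX_of_freePro_torsionGenerated` — the closer p492999 with
  `huniq` DISCHARGED from the displayed origin law `hgenC′` (e) at the primed core and `hfree′`; remaining displayed
  binders: DATA `C C′ A` · instance/origin-shaped `hfree hfree′ hgenC′` · LAW `hL L′ h0 h0′ hext hextC hA hA′ hIH′`.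

HONEST FRAMING: elementary profinite group theory over the tree's interfaces; `hgenC′` is an assumption label for a
classical property of the specific orbicurve `C_K` (an origin law like census object (A)), not a theorem about every
`PuncturedEllipticData`; typed ≠ discharged for the anabelian inputs; nothing here bears on [IUTchIII] Cor. 3.12 or
asserts that abc is proved or refuted.  No `def`, no instance, no new `Prop` fact; axioms standard.
-/

noncomputable section

namespace Literature.IUT.HodgeTheaters

namespace PuncturedEllipticData

open scoped Pointwise
open Literature.AnabelianGeometry.AbsoluteAnabelian
open Literature.AnabelianGeometry.AbsoluteAnabelian.FundamentalExtension (CuspidalAlgorithm)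

universe u

variable (D : PuncturedEllipticData.{u})

/-- An element of finite order of `G` lying in a subgroup `H` has finite order in `↥H`. [folklore] -/
private theorem isOfFinOrder_subtype_mk {G : Type u} [Group G] {H : Subgroup G} {g : G} (hg : g ∈ H)
    (h : IsOfFinOrder g) : IsOfFinOrder (⟨g, hg⟩ : H) := by
  obtain ⟨n, hn, hgn⟩ := isOfFinOrder_iff_pow_eq_one.mp h
  exact isOfFinOrder_iff_pow_eq_one.mpr ⟨n, hn, Subtype.ext (by simp [hgn])⟩

/-- **Uniqueness of the double covering of the orbicurve `C` by a hyperbolic CURVE, from "`Δ_C` is topologically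
generated by its torsion"** ([AbsTopII] Cor. 3.3 (ii) / Rmk. 3.1.1 at a `PuncturedEllipticData`): if every element
of `Δ_C` lies in the closure of the subgroup generated by the finite-order elements of `Δ_C` (origin law (e) of
`C = X/{±1}`) and `Δ_X = Π_X ∩ Δ_C` is torsion-free, then every OPEN subgroup `J ⊆ Π_C` of index `2` whose geometric
part `J ∩ Δ_C` is torsion-free satisfies `J ∩ Δ_C = Δ_X`.  (The subgroup `{g | g ∈ J ↔ g ∈ Π_X}` is clopen and
contains the torsion of `Δ_C`.) ([IUTchI] Cor 1.2 p.39) [claim: Mochizuki2012, status: disputed] -/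
theorem inf_deltaC_eq_of_torsionGenerated
    (hgen : D.DeltaC ≤ (Subgroup.closure {g : D.PiC | g ∈ D.DeltaC ∧ IsOfFinOrder g}).topologicalClosure)
    (htf : ∀ g : ↥(D.PiX ⊓ D.DeltaC), IsOfFinOrder g → g = 1)
    (J : Subgroup D.PiC) (hJo : IsOpen (J : Set D.PiC)) (hJ2 : J.index = 2)
    (hJtf : ∀ g : ↥(J ⊓ D.DeltaC), IsOfFinOrder g → g = 1) :
    J ⊓ D.DeltaC = D.PiX ⊓ D.DeltaC := by
  -- the subgroup `S = {g | g ∈ J ↔ g ∈ Π_X}`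
  let S : Subgroup D.PiC :=
    { carrier := {g | g ∈ J ↔ g ∈ D.PiX}
      one_mem' := by
        change (1 : D.PiC) ∈ J ↔ (1 : D.PiC) ∈ D.PiX
        exact ⟨fun _ => D.PiX.one_mem, fun _ => J.one_mem⟩
      mul_mem' := fun {a b} ha hb => by
        change (a ∈ J ↔ a ∈ D.PiX) at ha
        change (b ∈ J ↔ b ∈ D.PiX) at hb
        change (a * b ∈ J ↔ a * b ∈ D.PiX)
        rw [Subgroup.mul_mem_iff_of_index_two hJ2, Subgroup.mul_mem_iff_of_index_two D.index_piX]
        tauto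
      inv_mem' := fun {a} ha => by
        change (a ∈ J ↔ a ∈ D.PiX) at ha
        change (a⁻¹ ∈ J ↔ a⁻¹ ∈ D.PiX)
        rw [inv_mem_iff, inv_mem_iff]
        exact ha }
  have hS : ∀ g : D.PiC, g ∈ S ↔ (g ∈ J ↔ g ∈ D.PiX) := fun _ => Iff.rfl
  -- `S` is closed (indeed clopen: `J`, `Π_X` are open, hence closed, subgroups)
  have hSc : IsClosed (S : Set D.PiC) := by
    have hJc : IsClosed (J : Set D.PiC) := J.isClosed_of_isOpen hJo
    have hXc : IsClosed (D.PiX : Set D.PiC) := D.PiX.isClosed_of_isOpen D.isOpen_piX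
    have hset : (S : Set D.PiC) =
        ((J : Set D.PiC) ∩ (D.PiX : Set D.PiC)) ∪ ((J : Set D.PiC)ᶜ ∩ (D.PiX : Set D.PiC)ᶜ) := by
      ext g
      simp only [Set.mem_union, Set.mem_inter_iff, Set.mem_compl_iff, SetLike.mem_coe, hS]
      tauto
    rw [hset]
    exact (hJc.inter hXc).union
      ((isClosed_compl_iff.mpr hJo).inter (isClosed_compl_iff.mpr D.isOpen_piX))
  -- every finite-order element of `Δ_C` lies in `S`
  have htor : {g : D.PiC | g ∈ D.DeltaC ∧ IsOfFinOrder g} ⊆ (S : Set D.PiC) := by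
    rintro g ⟨hgC, hgfin⟩
    rw [SetLike.mem_coe, hS]
    constructor
    · intro hgJ
      have h1 : (⟨g, Subgroup.mem_inf.mpr ⟨hgJ, hgC⟩⟩ : ↥(J ⊓ D.DeltaC)) = 1 :=
        hJtf _ (isOfFinOrder_subtype_mk _ hgfin)
      have hg1 : g = 1 := congrArg Subtype.val h1
      rw [hg1]
      exact D.PiX.one_mem
    · intro hgX
      have h1 : (⟨g, Subgroup.mem_inf.mpr ⟨hgX, hgC⟩⟩ : ↥(D.PiX ⊓ D.DeltaC)) = 1 :=
        htf _ (isOfFinOrder_subtype_mk _ hgfin)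
      have hg1 : g = 1 := congrArg Subtype.val h1
      rw [hg1]
      exact J.one_mem
  -- hence `Δ_C ⊆ S`
  have hΔS : D.DeltaC ≤ S :=
    hgen.trans (Subgroup.topologicalClosure_minimal _ ((Subgroup.closure_le S).mpr htor) hSc)
  -- conclusion
  ext g
  simp only [Subgroup.mem_inf]
  constructor
  · rintro ⟨hgJ, hgC⟩
    exact ⟨((hS g).mp (hΔS hgC)).mp hgJ, hgC⟩
  · rintro ⟨hgX, hgC⟩
    exact ⟨((hS g).mp (hΔS hgC)).mpr hgX, hgC⟩

/-- **The print-form `huniq` of the repaired Cor. 1.2 closer (p492999), DERIVED** from the origin law (e)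
"`Δ_C` topologically generated by its torsion" and «`Δ_X` free profinite of rank 2» (torsion-freeness via p491635).
([IUTchI] Cor 1.2 p.39) [claim: Mochizuki2012, status: disputed] -/
theorem huniq_of_torsionGenerated_of_isFreeProOn
    (hgen : D.DeltaC ≤ (Subgroup.closure {g : D.PiC | g ∈ D.DeltaC ∧ IsOfFinOrder g}).topologicalClosure)
    {gens : Fin 2 → ↥(D.PiX ⊓ D.DeltaC)} (hfree : IsFreeProOn ↥(D.PiX ⊓ D.DeltaC) Set.univ gens) :
    ∀ J : Subgroup D.PiC, IsOpen (J : Set D.PiC) → J.index = 2 →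
      (∀ g : ↥(J ⊓ D.DeltaC), IsOfFinOrder g → g = 1) → J ⊓ D.DeltaC = D.PiX ⊓ D.DeltaC :=
  fun J hJo hJ2 hJtf =>
    D.inf_deltaC_eq_of_torsionGenerated hgen (D.torsionFree_deltaX_of_isFreeProOn hfree) J hJo hJ2 hJtf

end PuncturedEllipticData

/-! ### The closer at the genuine `K`-level data with `huniq` discharged from (e) at the primed core -/

namespace InitialThetaData

open scoped Pointwise
open Literature.AnabelianGeometry.AbsoluteAnabelian
open Literature.AnabelianGeometry.AbsoluteAnabelian.FundamentalExtension (CuspidalAlgorithm)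

universe u u'

variable {F : Type u} {K : Type} {Fbar : Type} [Field F] [NumberField F] [Field K] [NumberField K]
  [Algebra F K] [Field Fbar] [Algebra F Fbar] [Algebra K Fbar]
  {E : WeierstrassCurve F} [E.IsElliptic] {l : ℕ} {Pb : BadPlacePredicates K}
  (D : InitialThetaData F K Fbar E l Pb)
  {F' : Type u'} {K' : Type} [Field F'] [NumberField F'] [Field K'] [NumberField K'] [Algebra F' K']
  {Fbar' : Type} [Field Fbar'] [Algebra F' Fbar'] [Algebra K' Fbar']
  {E' : WeierstrassCurve F'} [E'.IsElliptic] {l' : ℕ} {Pb' : BadPlacePredicates K'}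
  (D' : InitialThetaData F' K' Fbar' E' l' Pb')

/-- **[IUTchI] Cor. 1.2 between the `K`-level data of two initial Θ-data — the repaired closer p492999 with the
[AbsTopII] Cor. 3.3 (ii) uniqueness law `huniq` DISCHARGED** from the ORIGIN LAW (e) at the primed core
(`hgenC′` : "`Δ'_C` is topologically generated by its elements of finite order" — `C' = X'/{±1}`,
`Δ_{C'} ≅ (ℤ/2 ∗ ℤ/2 ∗ ℤ/2)^`) and `hfree′`.  Remaining displayed binders: DATA `C C′ A`; origin/instance-shaped
`hfree hfree′ hgenC′`; LAW `hL L′` (`ModLCuspLaws`), `h0 h0′` (GAP G-L5d4g6-1), `hext hextC` ([AbsTopII] Cor. 3.3 (i)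
extension form), `hA hA′` (F-0206 instances), `hIH′`. ([IUTchI] Cor 1.2 p.39) [claim: Mochizuki2012, status: disputed] -/
theorem pe_characteristicNatureOfCoverings_viaX_of_freePro_torsionGenerated
    (C : D.geom.pe.CuspGalois) (C' : D'.geom.pe.CuspGalois)
    (hL : D.geom.pe.ModLCuspLaws) (L' : D'.geom.pe.ModLCuspLaws)
    {gens : Fin 2 → ↥(D.geom.pe.PiX ⊓ D.geom.pe.DeltaC)}
    (hfree : IsFreeProOn ↥(D.geom.pe.PiX ⊓ D.geom.pe.DeltaC) Set.univ gens)
    {gens' : Fin 2 → ↥(D'.geom.pe.PiX ⊓ D'.geom.pe.DeltaC)}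
    (hfree' : IsFreeProOn ↥(D'.geom.pe.PiX ⊓ D'.geom.pe.DeltaC) Set.univ gens')
    (hgenC' : D'.geom.pe.DeltaC ≤ (Subgroup.closure
      {g : D'.geom.pe.PiC | g ∈ D'.geom.pe.DeltaC ∧ IsOfFinOrder g}).topologicalClosure)
    (h0 : ¬ D.geom.pe.inertia D.geom.pe.ε0 ≤ D.geom.pe.piXarrow)
    (h0' : ¬ D'.geom.pe.inertia D'.geom.pe.ε0 ≤ D'.geom.pe.piXarrow)
    (hext : ∀ φ : D.geom.pe.piXarrow ≃* D'.geom.pe.piXarrow, Continuous φ → Continuous φ.symm →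
      ∃ Θ : D.geom.pe.PiC ≃ₜ* D'.geom.pe.PiC,
        ∀ x : D.geom.pe.piXarrow, Θ (x : D.geom.pe.PiC) = (φ x : D'.geom.pe.PiC))
    (hextC : ∀ ψ : D.geom.pe.piCarrow ≃* D'.geom.pe.piCarrow, Continuous ψ → Continuous ψ.symm →
      ∃ Θ : D.geom.pe.PiC ≃ₜ* D'.geom.pe.PiC,
        ∀ x : D.geom.pe.piCarrow, Θ (x : D.geom.pe.PiC) = (ψ x : D'.geom.pe.PiC))
    (A : CuspidalAlgorithm.{0}) (hA : A.RecoversCusps D.geom.pe.extXbar C.cuspidalDataXbar)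
    (hA' : A.RecoversCusps D'.geom.pe.extXbar C'.cuspidalDataXbar)
    (hIH' : ∀ x : D'.geom.pe.Cusp, D'.geom.pe.inertia x ≤
      (⁅D'.geom.pe.PiX ⊓ D'.geom.pe.DeltaC, D'.geom.pe.PiX ⊓ D'.geom.pe.DeltaC⁆ ⊔
        Subgroup.closure ((fun y : D'.geom.pe.PiC => y ^ D'.geom.pe.l) ''
          (D'.geom.pe.PiX ⊓ D'.geom.pe.DeltaC : Set D'.geom.pe.PiC))).topologicalClosure) :
    D.geom.pe.CharacteristicNatureOfCoverings D'.geom.pe :=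
  D.pe_characteristicNatureOfCoverings_viaX_of_freePro_faithful D' C C' hL L' hfree hfree' h0 h0'
    (D'.geom.pe.huniq_of_torsionGenerated_of_isFreeProOn hgenC' hfree') hext hextC A hA hA' hIH'

end InitialThetaData

end Literature.IUT.HodgeTheaters
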